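import Mathlib
import Summits.Ventures.HodgeRepro2.T6A1WeilCEq

/-!
# T6A1Hodge — the complex split Weil space consists of `(2,2)`-classes (Lemma A1.2, «if» direction)

Tier-6 sub-goal A1 (route/T6-A1-t6-p1.md §1 (A1.ii); TARGET-T6.md §2 Layer II). TIER4 Lemma A1.2: for a
balanced face (every embedding `σ` lies in exactly two of the four CM types, p1's `IsWeilFace`) the
complex Weil space `W_ℂ = ⊕_σ ℂ·e_{1,σ} ∧ e_{2,σ} ∧ e_{3,σ} ∧ e_{4,σ}` lies in `H^{2,2}(B)`: each
`w_σ` has exactly two factors from `H^{1,0}` (the lines `ℓ_{i,σ}` with `σ ∈ T_i`, Lemma A0.5) and two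
from `H^{0,1}`, and the factors of a wedge anticommute, so the monomial is `± (h^{1,0} ∧ h^{1,0}) ∧
(h^{0,1} ∧ h^{0,1})` — in the interface's vocabulary `weilC F ≤ hodge F 2 2` (`weilC_le_hodge`).
-/

namespace Summit.Ventures.HodgeRepro2.T6.A1Hodge

open A2Model A1WeilCEq

section reorder

variable {R : Type*} [Ring R] {S : Type*} [Ring S] [Module S R] [IsScalarTower S R R]

/-- A product of two anticommuting generators commutes with a third. -/
theorem even_comm (x : Fin 4 → R) (hswap : ∀ i j, x i * x j = -(x j * x i)) (i j k : Fin 4) :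
    x i * x j * x k = x k * (x i * x j) := by
  rw [mul_assoc, hswap j k, mul_neg, ← mul_assoc, hswap i k, neg_mul, neg_neg, mul_assoc]

/-- Two products of two anticommuting generators commute. -/
theorem pair_comm (x : Fin 4 → R) (hswap : ∀ i j, x i * x j = -(x j * x i)) (i j k l : Fin 4) :
    x i * x j * (x k * x l) = x k * x l * (x i * x j) := by
  rw [← mul_assoc, even_comm x hswap i j k, mul_assoc, even_comm x hswap i j l, ← mul_assoc]

/-- Four pairwise anticommuting elements, two in `A` (positions `a ≠ b`) and two in `B`: their product
in the given order lies in `A · A · (B · B)`. -/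
theorem prod_mem_sq_mul_sq {A B : Submodule S R} (x : Fin 4 → R)
    (hswap : ∀ i j, x i * x j = -(x j * x i)) (a b : Fin 4) (hab : a ≠ b)
    (hA : ∀ i, i = a ∨ i = b → x i ∈ A) (hB : ∀ i, i ≠ a → i ≠ b → x i ∈ B) :
    x 0 * x 1 * x 2 * x 3 ∈ A * A * (B * B) := by
  have mm : ∀ {p q r s : R}, p ∈ A → q ∈ A → r ∈ B → s ∈ B → p * q * (r * s) ∈ A * A * (B * B) :=
    fun hp hq hr hs => Submodule.mul_mem_mul (Submodule.mul_mem_mul hp hq) (Submodule.mul_mem_mul hr hs)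
  have c01 : x 0 ∈ A → x 1 ∈ A → x 2 ∈ B → x 3 ∈ B → x 0 * x 1 * x 2 * x 3 ∈ A * A * (B * B) := by
    intro h0 h1 h2 h3
    rw [mul_assoc (x 0 * x 1)]
    exact mm h0 h1 h2 h3
  have c02 : x 0 ∈ A → x 2 ∈ A → x 1 ∈ B → x 3 ∈ B → x 0 * x 1 * x 2 * x 3 ∈ A * A * (B * B) := by
    intro h0 h2 h1 h3
    have : x 0 * x 1 * x 2 * x 3 = -(x 0 * x 2 * (x 1 * x 3)) := by
      rw [mul_assoc (x 0) (x 1), hswap 1 2, mul_neg, neg_mul, ← mul_assoc, mul_assoc (x 0 * x 2)]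
    rw [this, Submodule.neg_mem_iff]
    exact mm h0 h2 h1 h3
  have c03 : x 0 ∈ A → x 3 ∈ A → x 1 ∈ B → x 2 ∈ B → x 0 * x 1 * x 2 * x 3 ∈ A * A * (B * B) := by
    intro h0 h3 h1 h2
    have : x 0 * x 1 * x 2 * x 3 = x 0 * x 3 * (x 1 * x 2) := by
      rw [mul_assoc (x 0) (x 1), mul_assoc (x 0), even_comm x hswap 1 2 3, ← mul_assoc]
    rw [this]
    exact mm h0 h3 h1 h2
  have c12 : x 1 ∈ A → x 2 ∈ A → x 0 ∈ B → x 3 ∈ B → x 0 * x 1 * x 2 * x 3 ∈ A * A * (B * B) := by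
    intro h1 h2 h0 h3
    have : x 0 * x 1 * x 2 * x 3 = x 1 * x 2 * (x 0 * x 3) := by
      rw [mul_assoc (x 0) (x 1), ← even_comm x hswap 1 2 0, mul_assoc (x 1 * x 2)]
    rw [this]
    exact mm h1 h2 h0 h3
  have c13 : x 1 ∈ A → x 3 ∈ A → x 0 ∈ B → x 2 ∈ B → x 0 * x 1 * x 2 * x 3 ∈ A * A * (B * B) := by
    intro h1 h3 h0 h2
    have : x 0 * x 1 * x 2 * x 3 = -(x 1 * x 3 * (x 0 * x 2)) := by
      rw [mul_assoc (x 0 * x 1), hswap 2 3, mul_neg, ← mul_assoc, mul_assoc (x 0) (x 1),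
        ← even_comm x hswap 1 3 0, mul_assoc (x 1 * x 3)]
    rw [this, Submodule.neg_mem_iff]
    exact mm h1 h3 h0 h2
  have c23 : x 2 ∈ A → x 3 ∈ A → x 0 ∈ B → x 1 ∈ B → x 0 * x 1 * x 2 * x 3 ∈ A * A * (B * B) := by
    intro h2 h3 h0 h1
    have : x 0 * x 1 * x 2 * x 3 = x 2 * x 3 * (x 0 * x 1) := by
      rw [mul_assoc (x 0 * x 1), pair_comm x hswap 0 1 2 3]
    rw [this]
    exact mm h2 h3 h0 h1
  fin_cases a <;> fin_cases b
  all_goals try exact (hab rfl).elim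
  all_goals simp only [Fin.zero_eta, Fin.mk_one, Fin.isValue, Fin.reduceFinMk] at hA hB
  all_goals first
    | exact c01 (hA 0 (by decide)) (hA 1 (by decide)) (hB 2 (by decide) (by decide))
        (hB 3 (by decide) (by decide))
    | exact c02 (hA 0 (by decide)) (hA 2 (by decide)) (hB 1 (by decide) (by decide))
        (hB 3 (by decide) (by decide))
    | exact c03 (hA 0 (by decide)) (hA 3 (by decide)) (hB 1 (by decide) (by decide))
        (hB 2 (by decide) (by decide))
    | exact c12 (hA 1 (by decide)) (hA 2 (by decide)) (hB 0 (by decide) (by decide))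
        (hB 3 (by decide) (by decide))
    | exact c13 (hA 1 (by decide)) (hA 3 (by decide)) (hB 0 (by decide) (by decide))
        (hB 2 (by decide) (by decide))
    | exact c23 (hA 2 (by decide)) (hA 3 (by decide)) (hB 0 (by decide) (by decide))
        (hB 1 (by decide) (by decide))

end reorder

variable (K : Type*) [Field K] [NumberField K]

/-- Generators of the exterior algebra anticommute (Mathlib's `ExteriorAlgebra.ι_add_mul_swap`). -/
theorem ι_mul_ι_swap (u v : H1C K) :
    ExteriorAlgebra.ι ℂ u * ExteriorAlgebra.ι ℂ v = -(ExteriorAlgebra.ι ℂ v * ExteriorAlgebra.ι ℂ u) :=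
  eq_neg_of_add_eq_zero_left (ExteriorAlgebra.ι_add_mul_swap u v)

/-- LEMMA A1.2 («if»), on the interface: for a balanced face the complex split Weil space lies in
`H^{2,2}(B)` — `weilC F ≤ hodge F 2 2` (TIER4 Lemma A1.2; the «Hodge classes» clause of Theorem A1(ii)). -/
theorem weilC_le_hodge (F : FaceSetting K) : weilC F ≤ hodge F 2 2 := by
  classical
  refine iSup_le fun σ => ?_
  refine lineProd_le K σ _ fun u hu => ?_
  -- the two vertices with σ ∈ T i
  have hcard : (Finset.univ.filter fun i : Fin 4 => σ ∈ F.T i).card = 2 := by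
    have := F.face.2 σ
    rw [Nat.card_eq_fintype_card, Fintype.card_subtype] at this
    exact this
  obtain ⟨a, b, hab, hset⟩ := Finset.card_eq_two.1 hcard
  have hmem : ∀ i : Fin 4, σ ∈ F.T i ↔ i = a ∨ i = b := by
    intro i
    have := Finset.ext_iff.1 hset i
    simpa [Finset.mem_filter, Finset.mem_insert, Finset.mem_singleton] using this
  have hsq : hodge F 2 2 = ιW (h10 F) * ιW (h10 F) * (ιW (h01 F) * ιW (h01 F)) := by
    unfold hodge
    rw [pow_two, pow_two]
  rw [hsq]
  refine prod_mem_sq_mul_sq (fun i => ExteriorAlgebra.ι ℂ (u i)) (fun i j => ι_mul_ι_swap K _ _)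
    a b hab (fun i hi => ?_) (fun i hia hib => ?_)
  · exact ι_mem_ιW_h10 F ((hmem i).2 hi) (hu i)
  · exact ι_mem_ιW_h01 F (fun h => by rcases (hmem i).1 h with h | h <;> [exact hia h; exact hib h]) (hu i)

/-- THEOREM A1(ii), the «Hodge classes» clause (TIER4 Lemma A1.2 + Lemma A1.3): every element of the
rational split Weil line `weilQ K` is a Hodge class of type `(2,2)` — its complexification lies in
`hodge F 2 2`. -/
theorem extC_mem_hodge_of_mem_weilQ [IsGalois ℚ K] (F : FaceSetting K) {w : HB K} (hw : w ∈ weilQ K) :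
    extC K w ∈ hodge F 2 2 := by
  classical
  have h1 : extC K w ∈ Submodule.span ℂ (extC K '' (weilQ K : Set (HB K))) :=
    Submodule.subset_span ⟨w, hw, rfl⟩
  rw [span_extC_weilQ_eq_weilC K F] at h1
  exact weilC_le_hodge K F h1

/-- The Hodge decomposition of `H¹(B, ℂ)` spans: `H^{1,0} + H^{0,1} = H¹(B, ℂ)` (TIER4 (A0.3)(iii),
Lemma A0.5: every eigenline lies in `h10 F` or in `h01 F`). -/
theorem h10_sup_h01_eq_top (F : FaceSetting K) : h10 F ⊔ h01 F = ⊤ := by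
  classical
  rw [eq_top_iff, ← A1Complex.iSup_eigenSpace_eq_top K]
  refine iSup_le fun σ => ?_
  unfold A1Complex.eigenSpace
  refine iSup_le fun i => ?_
  by_cases h : σ ∈ F.T i
  · exact le_sup_of_le_left (le_iSup_of_le i (le_iSup_of_le σ (le_iSup_of_le h le_rfl)))
  · exact le_sup_of_le_right (le_iSup_of_le i (le_iSup_of_le σ (le_iSup_of_le h le_rfl)))

end Summit.Ventures.HodgeRepro2.T6.A1Hodge
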